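import Summits.HodgeConjecture.HodgeConjecture.Theses.PadicSemiregularLift
import Summits.HodgeConjecture.HodgeConjecture.Theses.TropicalCuspLift
import Literature.AlgebraicGeometry.HodgeTheory.WeilClasses
import Literature.AlgebraicGeometry.HodgeTheory.WeilClassesFourfolds
import Literature.AlgebraicGeometry.HodgeTheory.LefschetzOneOne
import Literature.AlgebraicGeometry.Motives.HyperbolicWeilType
import Literature.AlgebraicGeometry.Motives.AbelianVarietyProduct
import Literature.AlgebraicGeometry.Motives.FamiliesVHS

/-!
# Sketch (crux-ideate round 1, ideator 2, generation 2) for crux `HodgeAbelianVarieties`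
(stmt-HodgeConjecture-1333), route `PadicSemiregularLift`.

First lemmas of the two idea cards filed by this seat in generation 2:

* `level-one-window-picard-loci`: `lDeterminantClasses`, `LevelOneWindow`,
  `levelOneWindow_of_coniveau` (signature).
* `surface-swap-discriminant-surgery`: `SurfaceSwapTransport`, `weilSixfolds_of_surfaceSwap`
  (signature).

Everything is stated over the tree's REAL carriers (`AbelianVariety ℂ`, `complexBetti`,
`pullbackEigenclasses`, `weilClassesOf`, `supportedClasses`, `algebraicClasses`,
`IsHyperbolicWeilType`, `fiberOver`/`fiberι`). `sorry` only in the two signature theorems.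
-/

noncomputable section

open CategoryTheory

namespace Summit.HodgeConjecture.HodgeConjecture.Cruxes.HodgeAbelianVarieties.IdeatorTwoGen2

open Literature.AlgebraicGeometry Literature.AlgebraicGeometry.HodgeTheory
  Literature.AlgebraicGeometry.Motives
open Summit.HodgeConjecture.HodgeConjecture.Theses.PadicSemiregularLift

/-! ## Card 1 — the level-one window on biquadratic-CM loci -/

section LevelOne

variable (B : AbelianVariety ℂ) (φ ψ : B ⟶ B)

/-- One complexified `L`-determinant eigen-line `⋀³ V_τ ⊆ H³(B(ℂ); ℂ)` for the biquadratic CM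
field `L = ℚ(√-d, √t)` acting through `φ` (`φ² = -d`) and `ψ` (`ψ² = t`): the simultaneous
eigenclasses of `(x + yφ)^*` for the character `(x + ε·i·y√d)³` and of `(x + yψ)^*` for
`(x + ε'·y√t)³`, `ε, ε' ∈ {±1}`. In `H³ = ⋀³(⊕_τ V_τ)` the only summand `⋀ᵃV_{σ+} ⊗ ⋀ᵇV_{σ-} ⊗
⋀ᶜV_{σ̄+} ⊗ ⋀ᵉV_{σ̄-}` with these two characters is `(3,0,0,0)` (resp. its sign variants), so for
`L`-rank `3` this is exactly the line `⋀³V_τ`. [folklore] -/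
def lDetLine (d t : ℕ) (ε ε' : ℂ) : Submodule ℂ (complexBetti B.X 3) :=
  pullbackEigenclasses B φ 3
      (fun x y => ((x : ℂ) + ε * (y : ℂ) * Complex.I * (Real.sqrt d : ℂ)) ^ 3)
    ⊓ pullbackEigenclasses B ψ 3 (fun x y => ((x : ℂ) + ε' * (y : ℂ) * (Real.sqrt t : ℂ)) ^ 3)

/-- The complexified `L`-DETERMINANT `D ⊗ ℂ = ⊕_τ ⋀³_ℂ V_τ ⊆ H³(B(ℂ); ℂ)` (`D = ⋀³_L H¹(B, ℚ)`,
a `4`-dimensional sub-Hodge structure of WEIGHT 3 and LEVEL 1 when `(B, L)` has signatures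
`(2,1), (1,2)`): the sum of the four eigen-lines. [folklore] -/
def lDeterminantClasses (d t : ℕ) : Submodule ℂ (complexBetti B.X 3) :=
  (lDetLine B φ ψ d t 1 1 ⊔ lDetLine B φ ψ d t 1 (-1)) ⊔
    (lDetLine B φ ψ d t (-1) 1 ⊔ lDetLine B φ ψ d t (-1) (-1))

/-- **The level-one window** (card `level-one-window-picard-loci`): for an abelian SIXFOLD `B`
with commuting endomorphisms `φ² = -d`, `ψ² = t` (biquadratic CM field `L = ℚ(√-d, √t)` acting,
`L`-rank `3`), IF every class of the `L`-determinant `D ⊆ H³(B)` is supported on a DIVISOR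
(coniveau `≥ 1`, Grothendieck's generalized Hodge conjecture for the level-one piece `D`), THEN
every rational `(3,3)`-class of the `ℚ(√-d)`-Weil plane `W = ⋀⁶_K H¹ = Nm_{L/K} D` is algebraic.
Paper proof: coniveau 1 gives a divisor `Y` with `D ⊆ Gysin(H¹(Ỹ)(-1))`; semisimplicity gives an
abelian surface quotient `S'` of `Alb(Ỹ)` with `H¹(S') ≅ D(1)` and an ALGEBRAIC correspondence
`Γ ⊆ S' × B` (Albanese graph ∘ inclusion) with `Γ_* H¹(S') = D`; the Weil class is
`w = Δ_B^* (Γ × Γ)_* ξ` where `ξ ∈ H¹(S') ⊗ H¹(S')` is of type `(1,1)` (pairs `V^{1,0}_{τ₁}` with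
`V^{0,1}_{τ₂}`), hence a DIVISOR class on `S' × S'` by Lefschetz `(1,1)`. [folklore] -/
def LevelOneWindow (d t : ℕ) : Prop :=
  ∀ (B : AbelianVariety ℂ) (φ ψ : B ⟶ B), B.dim = 2 * 3 → φ ≫ φ = -(d • 𝟙 B) →
    ψ ≫ ψ = (t • 𝟙 B) → φ ≫ ψ = ψ ≫ φ →
    (∀ c ∈ lDeterminantClasses B φ ψ d t, c ∈ supportedClasses B.X 3 1) →
    ∀ c ∈ weilClassesOf B φ 3 d, IsRationalClass c → IsOfHodgeType (2 * 3) B.X (2 * 3) 3 3 c →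
      c ∈ algebraicClasses B.X 3

/-- FIRST LEMMA of card 1 (signature): coniveau one for the level-one `L`-determinant plus
Lefschetz `(1,1)` (tree fact `lefschetzOneOne_rational`) gives the Weil classes. The degenerate
parameters are excluded (`d, t ≥ 1`, `t` not a square, so that `L` is a biquadratic CM field).
[folklore] -/
theorem levelOneWindow_of_coniveau (d t : ℕ) (hd : 0 < d) (ht : 0 < t) (hts : ¬ IsSquare t)
    (hL : lefschetzOneOne_rational) : LevelOneWindow d t := by
  sorry

end LevelOne

/-! ## Card 2 — surface swap (discriminant surgery at the object level) -/

/-- **Surface-swap transport** (card `surface-swap-discriminant-surgery`): transport of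
algebraicity of a fibrewise rational `(3,3)` class along a smooth projective family of sixfolds over
an irreducible base FROM A PRODUCT POINT `A₄ × S` whose fourfold factor is of HYPERBOLIC (split)
`ℚ(√-d)`-Weil type (where the descended secant object `F₄` lives) — the deformation statement the
glued `K`-twisted self-sums `⊕ η(a_j)^* F₄ ⊠ L_j` are meant to prove on the non-split Weil
components through `A₄ × S''`. [folklore] -/
def SurfaceSwapTransport (d : ℕ) : Prop :=
  ∀ ⦃𝒳 T : SchemeOver ℂ⦄ (f : 𝒳 ⟶ T), IsSmoothProjectiveFamily f (2 * 3) → IrreducibleSpace T.left →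
    ∀ (W : complexBetti 𝒳 (2 * 3)) (s₀ : ComplexPoints T) (A₄ S : AbelianVariety ℂ) (φ₄ : A₄ ⟶ A₄)
      (φS : S ⟶ S) (h₄ : complexBetti A₄.X 2),
      A₄.dim = 2 * 2 → S.dim = 2 * 1 → φ₄ ≫ φ₄ = -(d • 𝟙 A₄) → φS ≫ φS = -(d • 𝟙 S) →
      IsRationalClass h₄ → IsOfHodgeType (2 * 2) A₄.X 2 1 1 h₄ → IsHyperbolicWeilType A₄ φ₄ 2 h₄ →
      Nonempty ((A₄.prod S).X ≅ fiberOver f s₀) →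
      (∀ s : ComplexPoints T, IsRationalClass (complexBetti.map (fiberι f s) (2 * 3) W) ∧
        IsOfHodgeType (2 * 3) (fiberOver f s) (2 * 3) 3 3 (complexBetti.map (fiberι f s) (2 * 3) W)) →
      complexBetti.map (fiberι f s₀) (2 * 3) W ∈ algebraicClasses (fiberOver f s₀) 3 →
      ∀ s : ComplexPoints T,
        complexBetti.map (fiberι f s) (2 * 3) W ∈ algebraicClasses (fiberOver f s) 3

/-- FIRST LEMMA of card 2 (signature): surface-swap transport for every `d`, the tree's named fact
`Markman2025_weilClasses_algebraic_abelianFourfold` (every fourfold, every discriminant; used on the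
factor `A₄` and, via products with Weil surfaces, to make the class algebraic AT the product point)
imply the shared sixfold target `TropicalCuspLift.WeilSixfolds` (Weil classes on ALL abelian
sixfolds of Weil type, every `K = ℚ(√-d)`, every discriminant): every discriminant class `δ₆`
contains the products `A₄ × S''` with `A₄` hyperbolic (`disc 1`) and `disc S'' = δ₆`, the Weil
family through it is a smooth projective family over an irreducible (Shimura) base, and isogeny
descent (`WeilClassesIsogenyDescent`) moves between polarization types. [folklore] -/
theorem weilSixfolds_of_surfaceSwap (hT : ∀ d : ℕ, 0 < d → SurfaceSwapTransport d)
    (hM : Markman2025_weilClasses_algebraic_abelianFourfold) :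
    Summit.HodgeConjecture.HodgeConjecture.Theses.TropicalCuspLift.WeilSixfolds := by
  sorry

/-- Sanity link to the crux: the crux implies the sixfold target (specialisation of the Disproof
file's `weilItems_of`, restated here without importing the work file). [folklore] -/
theorem weilSixfolds_of_crux (h : HodgeAbelianVarieties) :
    Summit.HodgeConjecture.HodgeConjecture.Theses.TropicalCuspLift.WeilSixfolds := by
  intro d _ A φ hA _ _ c hc h33 _
  have h2 := (h A).2 3 c
  rw [hA] at h2
  exact h2 hc h33

end Summit.HodgeConjecture.HodgeConjecture.Cruxes.HodgeAbelianVarieties.IdeatorTwoGen2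

end
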